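import Mathlib
import HarnessLib

/-!
# Lateral-averaging calculus for stub (B) `MollifiedUpper` (line LayerChain v4, crux `StackingLiminf`,
# stmt-Ventures-19145): differentiation under / against the lateral kernel and the `L¹` contraction

Cell `crystal3d-full`, venture `Summits/Ventures/Crystal3D`.  The doubly mollified density of the line is a
LATERAL AVERAGE `(M_κ F)(y) = ∫_{ℝ²} κ(z) F(y − ι z) dz`, `ι z = (z₁, z₂, 0)` (`smooth x K L = M_{η_L}(dens x K)`
literally).  This file proves, for a general kernel `κ` on `ℝ × ℝ` and a general function `F` on `ℝ³`,
the three facts the integrated two-phase pairing (BLUEPRINT-v4B S3) consumes: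
* `integral_abs_lateral_le` — the `L¹` CONTRACTION `∫ |M_κ F| ≤ ‖κ‖₁ ‖F‖₁` (Tonelli + translation
  invariance of Lebesgue measure in the lateral variables);
* `hasFDerivAt_lateral` — for `F ∈ C¹_c` and `κ` continuous with compact support, `M_κ F` is differentiable
  with `D(M_κ F)(y) = ∫ κ(z) DF(y − ιz) dz` (the derivative falls on `F`: used for ALL bond directions);
* `fderiv_lateral_apply_of_horizontal` — for `κ ∈ C¹_c` and a HORIZONTAL direction `u` (`u₂ = 0`),
  `D(M_κ F)(y) u = ∫ Dκ(z)(u₀,u₁) F(y − ιz) dz` (the derivative falls on the KERNEL: translation of the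
  lateral variable and uniqueness of the derivative — this is what turns the skew term of the pairing
  into `‖∇η_L‖₁ ‖E‖₁ = O(‖E‖₁ / L)`).
WHAT THIS IS NOT: stub (B); rung F-C1 not moved.
-/

noncomputable section

namespace Summit.Ventures.Crystal3D.Theorems

open MeasureTheory Set Function Metric Filter Topology

/-- The lateral shift `y ↦ (y₀ − z₁, y₁ − z₂, y₂)` written coordinatewise is the vector difference
`y − ι z`. -/
theorem lateral_shift_eq (y : Fin 3 → ℝ) (z : ℝ × ℝ) :
    (fun j => y j - (![z.1, z.2, 0] : Fin 3 → ℝ) j) = y - ![z.1, z.2, 0] := rfl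

/-- **`L¹` contraction of lateral averaging.**  For an integrable `F` on `ℝ³` and a kernel `κ` on `ℝ²`
such that `(y, z) ↦ κ(z) F(y − ιz)` is integrable on the product, `∫ |∫ κ(z) F(y − ιz) dz| dy ≤ ‖κ‖₁ ‖F‖₁`. -/
theorem integral_abs_lateral_le (κ : ℝ × ℝ → ℝ) (F : (Fin 3 → ℝ) → ℝ)
    (hI : Integrable (uncurry fun (y : Fin 3 → ℝ) (z : ℝ × ℝ) =>
      κ z * F (fun j => y j - (![z.1, z.2, 0] : Fin 3 → ℝ) j)) (volume.prod volume)) :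
    ∫ y : Fin 3 → ℝ, |∫ z : ℝ × ℝ, κ z * F (fun j => y j - (![z.1, z.2, 0] : Fin 3 → ℝ) j)| ≤
      (∫ z, |κ z|) * ∫ y, |F y| := by
  have hIabs : Integrable (uncurry fun (y : Fin 3 → ℝ) (z : ℝ × ℝ) =>
      |κ z| * |F (fun j => y j - (![z.1, z.2, 0] : Fin 3 → ℝ) j)|) (volume.prod volume) := by
    have h := hI.abs
    refine h.congr (Eventually.of_forall fun p => ?_)
    simp only [uncurry, abs_mul]
  have h1 : ∀ y : Fin 3 → ℝ, |∫ z : ℝ × ℝ, κ z * F (fun j => y j - (![z.1, z.2, 0] : Fin 3 → ℝ) j)| ≤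
      ∫ z : ℝ × ℝ, |κ z| * |F (fun j => y j - (![z.1, z.2, 0] : Fin 3 → ℝ) j)| := by
    intro y
    have := abs_integral_le_integral_abs
      (f := fun z : ℝ × ℝ => κ z * F (fun j => y j - (![z.1, z.2, 0] : Fin 3 → ℝ) j)) (μ := volume)
    simpa only [abs_mul] using this
  have hinner : ∀ z : ℝ × ℝ, ∫ y : Fin 3 → ℝ, |κ z| * |F (fun j => y j - (![z.1, z.2, 0] : Fin 3 → ℝ) j)| =
      |κ z| * ∫ y, |F y| := by
    intro z
    rw [MeasureTheory.integral_const_mul]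
    congr 1
    have h : (fun y : Fin 3 → ℝ => |F (fun j => y j - (![z.1, z.2, 0] : Fin 3 → ℝ) j)|) =
        fun y => (fun y' => |F y'|) (y - ![z.1, z.2, 0]) := rfl
    rw [h, integral_sub_right_eq_self (fun y' => |F y'|)]
  calc ∫ y : Fin 3 → ℝ, |∫ z : ℝ × ℝ, κ z * F (fun j => y j - (![z.1, z.2, 0] : Fin 3 → ℝ) j)|
      ≤ ∫ y : Fin 3 → ℝ, ∫ z : ℝ × ℝ, |κ z| * |F (fun j => y j - (![z.1, z.2, 0] : Fin 3 → ℝ) j)| :=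
        integral_mono hI.integral_prod_left.abs hIabs.integral_prod_left h1
    _ = ∫ z : ℝ × ℝ, ∫ y : Fin 3 → ℝ, |κ z| * |F (fun j => y j - (![z.1, z.2, 0] : Fin 3 → ℝ) j)| :=
        integral_integral_swap hIabs
    _ = ∫ z : ℝ × ℝ, |κ z| * ∫ y, |F y| := integral_congr_ae (Eventually.of_forall hinner)
    _ = (∫ z, |κ z|) * ∫ y, |F y| := MeasureTheory.integral_mul_const _ _

/-- The integrand of a lateral average with continuous compactly supported kernel and continuous compactly
supported `F` is integrable on the product `ℝ³ × ℝ²`. -/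
theorem integrable_lateral_integrand (κ : ℝ × ℝ → ℝ) (hκc : Continuous κ) (hκs : HasCompactSupport κ)
    (F : (Fin 3 → ℝ) → ℝ) (hFc : Continuous F) (hFs : HasCompactSupport F) :
    Integrable (uncurry fun (y : Fin 3 → ℝ) (z : ℝ × ℝ) =>
      κ z * F (fun j => y j - (![z.1, z.2, 0] : Fin 3 → ℝ) j)) (volume.prod volume) := by
  have hι : Continuous fun p : (Fin 3 → ℝ) × (ℝ × ℝ) =>
      (fun j => p.1 j - (![p.2.1, p.2.2, 0] : Fin 3 → ℝ) j) :=
    continuous_pi fun j => by fin_cases j <;> simp <;> fun_prop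
  have hc : Continuous (uncurry fun (y : Fin 3 → ℝ) (z : ℝ × ℝ) =>
      κ z * F (fun j => y j - (![z.1, z.2, 0] : Fin 3 → ℝ) j)) :=
    (hκc.comp continuous_snd).mul (hFc.comp hι)
  refine hc.integrable_of_hasCompactSupport ?_
  -- support inside a product of closed balls
  obtain ⟨Rκ, hRκ⟩ := hκs.isCompact.isBounded.subset_closedBall 0
  obtain ⟨RF, hRF⟩ := hFs.isCompact.isBounded.subset_closedBall 0
  refine HasCompactSupport.intro ((isCompact_closedBall (0 : Fin 3 → ℝ) (RF + Rκ)).prod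
    (isCompact_closedBall (0 : ℝ × ℝ) Rκ)) fun p hp => ?_
  simp only [uncurry]
  rw [Set.mem_prod, not_and_or] at hp
  rcases hp with hy | hz
  · -- either κ vanishes or F vanishes
    by_cases hz : p.2 ∈ closedBall (0 : ℝ × ℝ) Rκ
    · have hFz : F (fun j => p.1 j - (![p.2.1, p.2.2, 0] : Fin 3 → ℝ) j) = 0 := by
        apply image_eq_zero_of_notMem_tsupport
        intro hmem
        have h1 := hRF hmem
        rw [mem_closedBall, dist_zero_right] at h1 hz
        rw [mem_closedBall, dist_zero_right, not_le] at hy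
        have hRκ0 : 0 ≤ Rκ := le_trans (norm_nonneg _) hz
        -- ‖p.1‖ ≤ ‖p.1 - ι z‖ + ‖ι z‖ ≤ RF + Rκ
        have hιn : ‖(![p.2.1, p.2.2, 0] : Fin 3 → ℝ)‖ ≤ Rκ := by
          refine (pi_norm_le_iff_of_nonneg hRκ0).2 fun j => ?_
          rw [Prod.norm_def] at hz
          have h1 : |p.2.1| ≤ Rκ := by
            have := le_trans (le_max_left _ _) hz; rwa [Real.norm_eq_abs] at this
          have h2 : |p.2.2| ≤ Rκ := by
            have := le_trans (le_max_right _ _) hz; rwa [Real.norm_eq_abs] at this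
          fin_cases j <;> simp [h1, h2, hRκ0]
        have : ‖p.1‖ ≤ ‖(fun j => p.1 j - (![p.2.1, p.2.2, 0] : Fin 3 → ℝ) j)‖ +
            ‖(![p.2.1, p.2.2, 0] : Fin 3 → ℝ)‖ := by
          have e : p.1 = (fun j => p.1 j - (![p.2.1, p.2.2, 0] : Fin 3 → ℝ) j) +
              (![p.2.1, p.2.2, 0] : Fin 3 → ℝ) := by
            funext j; simp
          conv_lhs => rw [e]
          exact norm_add_le _ _
        linarith
      rw [hFz, mul_zero]
    · rw [image_eq_zero_of_notMem_tsupport (fun h => hz (hRκ h)), zero_mul]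
  · rw [image_eq_zero_of_notMem_tsupport (fun h => hz (hRκ h)), zero_mul]

/-- **Differentiation under the lateral average (derivative on `F`).**  For `F ∈ C¹` with compact support
and a continuous compactly supported kernel `κ`, `y ↦ ∫ κ(z) F(y − ιz) dz` has derivative
`∫ κ(z) DF(y − ιz) dz`. -/
theorem hasFDerivAt_lateral (κ : ℝ × ℝ → ℝ) (hκc : Continuous κ) (hκs : HasCompactSupport κ)
    (F : (Fin 3 → ℝ) → ℝ) (hF : ContDiff ℝ 1 F) (hFs : HasCompactSupport F) (y : Fin 3 → ℝ) :
    HasFDerivAt (fun y : Fin 3 → ℝ => ∫ z : ℝ × ℝ, κ z * F (fun j => y j - (![z.1, z.2, 0] : Fin 3 → ℝ) j))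
      (∫ z : ℝ × ℝ, κ z • fderiv ℝ F (fun j => y j - (![z.1, z.2, 0] : Fin 3 → ℝ) j)) y := by
  have hFd : Differentiable ℝ F := hF.differentiable one_ne_zero
  have hFc' : Continuous (fderiv ℝ F) := hF.continuous_fderiv one_ne_zero
  obtain ⟨C, hC⟩ := hFc'.bounded_above_of_compact_support (hFs.fderiv (𝕜 := ℝ))
  have hιc : ∀ x : Fin 3 → ℝ, Continuous fun z : ℝ × ℝ =>
      (fun j => x j - (![z.1, z.2, 0] : Fin 3 → ℝ) j) :=
    fun x => continuous_pi fun j => by fin_cases j <;> simp <;> fun_prop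
  refine hasFDerivAt_integral_of_dominated_of_fderiv_le (𝕜 := ℝ) (μ := (volume : Measure (ℝ × ℝ)))
    (s := univ) (x₀ := y) univ_mem
    (F := fun (x : Fin 3 → ℝ) (z : ℝ × ℝ) => κ z * F (fun j => x j - (![z.1, z.2, 0] : Fin 3 → ℝ) j))
    (F' := fun (x : Fin 3 → ℝ) (z : ℝ × ℝ) => κ z • fderiv ℝ F (fun j => x j - (![z.1, z.2, 0] : Fin 3 → ℝ) j))
    (bound := fun z => |κ z| * C) ?_ ?_ ?_ ?_ ?_ ?_
  · exact Eventually.of_forall fun x =>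
      (hκc.mul (hF.continuous.comp (hιc x))).aestronglyMeasurable
  · exact (hκc.mul (hF.continuous.comp (hιc y))).integrable_of_hasCompactSupport hκs.mul_right
  · exact (hκc.smul (hFc'.comp (hιc y))).aestronglyMeasurable
  · refine Eventually.of_forall fun z x _ => ?_
    rw [norm_smul, Real.norm_eq_abs]
    exact mul_le_mul_of_nonneg_left (hC _) (abs_nonneg _)
  · exact (hκc.abs.integrable_of_hasCompactSupport hκs.abs).mul_const C
  · refine Eventually.of_forall fun z x _ => ?_
    have hsh : HasFDerivAt (fun x : Fin 3 → ℝ => (fun j => x j - (![z.1, z.2, 0] : Fin 3 → ℝ) j))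
        (ContinuousLinearMap.id ℝ (Fin 3 → ℝ)) x := by
      have := (hasFDerivAt_id (𝕜 := ℝ) x).sub_const (![z.1, z.2, 0] : Fin 3 → ℝ)
      exact this
    have h1 : HasFDerivAt (fun x : Fin 3 → ℝ => F (fun j => x j - (![z.1, z.2, 0] : Fin 3 → ℝ) j))
        (fderiv ℝ F (fun j => x j - (![z.1, z.2, 0] : Fin 3 → ℝ) j)) x := by
      have h := (hFd (fun j => x j - (![z.1, z.2, 0] : Fin 3 → ℝ) j)).hasFDerivAt.comp x hsh
      rw [ContinuousLinearMap.comp_id] at h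
      exact h
    exact h1.const_mul (κ z)

/-- The derivative of the lateral average, applied to a vector: `D(M_κ F)(y) u = ∫ κ(z) DF(y − ιz) u dz`. -/
theorem fderiv_lateral_apply (κ : ℝ × ℝ → ℝ) (hκc : Continuous κ) (hκs : HasCompactSupport κ)
    (F : (Fin 3 → ℝ) → ℝ) (hF : ContDiff ℝ 1 F) (hFs : HasCompactSupport F) (y u : Fin 3 → ℝ) :
    fderiv ℝ (fun y : Fin 3 → ℝ => ∫ z : ℝ × ℝ, κ z * F (fun j => y j - (![z.1, z.2, 0] : Fin 3 → ℝ) j)) y u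
      = ∫ z : ℝ × ℝ, κ z * fderiv ℝ F (fun j => y j - (![z.1, z.2, 0] : Fin 3 → ℝ) j) u := by
  rw [(hasFDerivAt_lateral κ hκc hκs F hF hFs y).fderiv]
  have hιc : Continuous fun z : ℝ × ℝ => (fun j => y j - (![z.1, z.2, 0] : Fin 3 → ℝ) j) :=
    continuous_pi fun j => by fin_cases j <;> simp <;> fun_prop
  have hint : Integrable (fun z : ℝ × ℝ => κ z • fderiv ℝ F (fun j => y j - (![z.1, z.2, 0] : Fin 3 → ℝ) j)) :=
    (hκc.smul ((hF.continuous_fderiv one_ne_zero).comp hιc)).integrable_of_hasCompactSupport hκs.smul_right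
  rw [ContinuousLinearMap.integral_apply hint u]
  refine integral_congr_ae (Eventually.of_forall fun z => ?_)
  simp

/-- Translating the lateral variable: for a horizontal `u` (`u₂ = 0`) and every `t`,
`∫ κ(z) F(y + t u − ιz) dz = ∫ κ(z + t (u₀,u₁)) F(y − ιz) dz`. -/
theorem lateral_translate (κ : ℝ × ℝ → ℝ) (F : (Fin 3 → ℝ) → ℝ) (y u : Fin 3 → ℝ) (hu : u 2 = 0)
    (t : ℝ) :
    ∫ z : ℝ × ℝ, κ z * F (fun j => (y + t • u) j - (![z.1, z.2, 0] : Fin 3 → ℝ) j) =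
      ∫ z : ℝ × ℝ, κ (z + t • (u 0, u 1)) * F (fun j => y j - (![z.1, z.2, 0] : Fin 3 → ℝ) j) := by
  rw [← integral_add_right_eq_self
    (fun z : ℝ × ℝ => κ z * F (fun j => (y + t • u) j - (![z.1, z.2, 0] : Fin 3 → ℝ) j)) (t • (u 0, u 1))]
  refine integral_congr_ae (Eventually.of_forall fun z => ?_)
  simp only
  congr 2
  funext j
  fin_cases j <;> simp [hu]

/-- **Differentiation against the lateral kernel (horizontal directions).**  For `κ ∈ C¹` with compact
support, `F ∈ C¹` with compact support and a HORIZONTAL direction `u` (`u₂ = 0`):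
`D(M_κ F)(y) u = ∫ Dκ(z)(u₀,u₁) F(y − ιz) dz`. -/
theorem fderiv_lateral_apply_of_horizontal (κ : ℝ × ℝ → ℝ) (hκ : ContDiff ℝ 1 κ)
    (hκs : HasCompactSupport κ) (F : (Fin 3 → ℝ) → ℝ) (hF : ContDiff ℝ 1 F) (hFs : HasCompactSupport F)
    (y u : Fin 3 → ℝ) (hu : u 2 = 0) :
    fderiv ℝ (fun y : Fin 3 → ℝ => ∫ z : ℝ × ℝ, κ z * F (fun j => y j - (![z.1, z.2, 0] : Fin 3 → ℝ) j)) y u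
      = ∫ z : ℝ × ℝ, fderiv ℝ κ z (u 0, u 1) * F (fun j => y j - (![z.1, z.2, 0] : Fin 3 → ℝ) j) := by
  set Φ : (Fin 3 → ℝ) → ℝ := fun y => ∫ z : ℝ × ℝ, κ z * F (fun j => y j - (![z.1, z.2, 0] : Fin 3 → ℝ) j)
    with hΦ
  set u' : ℝ × ℝ := (u 0, u 1) with hu'
  have hκc : Continuous κ := hκ.continuous
  have hκd : Differentiable ℝ κ := hκ.differentiable one_ne_zero
  have hκc' : Continuous (fderiv ℝ κ) := hκ.continuous_fderiv one_ne_zero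
  -- (1) the derivative of `t ↦ Φ (y + t u)` at `0` is `fderiv Φ y u`
  have hD := hasFDerivAt_lateral κ hκc hκs F hF hFs y
  have hline : HasDerivAt (fun t : ℝ => y + t • u) u 0 := by
    have := ((hasDerivAt_id (0 : ℝ)).smul_const u).const_add y
    simpa using this
  have hA : HasDerivAt (fun t : ℝ => Φ (y + t • u)) (fderiv ℝ Φ y u) 0 := by
    have h := hD.comp_hasDerivAt_of_eq (0 : ℝ) hline (by simp)
    rw [hD.fderiv]
    exact h
  -- (2) the same function, written with the translated kernel, differentiated under the integral
  have hrew : (fun t : ℝ => Φ (y + t • u)) =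
      fun t => ∫ z : ℝ × ℝ, κ (z + t • u') * F (fun j => y j - (![z.1, z.2, 0] : Fin 3 → ℝ) j) := by
    funext t
    exact lateral_translate κ F y u hu t
  have hιc : Continuous fun z : ℝ × ℝ => (fun j => y j - (![z.1, z.2, 0] : Fin 3 → ℝ) j) :=
    continuous_pi fun j => by fin_cases j <;> simp <;> fun_prop
  set G : ℝ × ℝ → ℝ := fun z => F (fun j => y j - (![z.1, z.2, 0] : Fin 3 → ℝ) j) with hG
  have hGc : Continuous G := hF.continuous.comp hιc
  obtain ⟨CF, hCF⟩ := hF.continuous.bounded_above_of_compact_support hFs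
  obtain ⟨Cκ, hCκ⟩ := hκc'.bounded_above_of_compact_support (hκs.fderiv (𝕜 := ℝ))
  obtain ⟨R, hR⟩ := hκs.isCompact.isBounded.subset_closedBall 0
  have hCF0 : 0 ≤ CF := le_trans (norm_nonneg _) (hCF 0)
  have hCκ0 : 0 ≤ Cκ := le_trans (norm_nonneg _) (hCκ 0)
  -- outside the ball of radius `R + ‖u'‖ + 1`, `fderiv κ (z + t u') = 0` for `|t| < 1`
  have hvan : ∀ z : ℝ × ℝ, z ∉ closedBall (0 : ℝ × ℝ) (R + ‖u'‖) → ∀ t : ℝ, t ∈ ball (0 : ℝ) 1 →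
      fderiv ℝ κ (z + t • u') = 0 := by
    intro z hz t ht
    have hnot : z + t • u' ∉ tsupport κ := by
      intro hmem
      have h1 := hR hmem
      rw [mem_closedBall, dist_zero_right] at h1 hz
      rw [mem_ball, dist_zero_right, Real.norm_eq_abs] at ht
      have : ‖z‖ ≤ ‖z + t • u'‖ + ‖t • u'‖ := by
        have := norm_add_le (z + t • u') (-(t • u'))
        simpa using this
      rw [norm_smul, Real.norm_eq_abs] at this
      have : |t| * ‖u'‖ ≤ 1 * ‖u'‖ := mul_le_mul_of_nonneg_right ht.le (norm_nonneg _)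
      push Not at hz
      linarith
    exact notMem_support.mp fun h => hnot (support_fderiv_subset ℝ h)
  have hB := hasDerivAt_integral_of_dominated_loc_of_deriv_le (μ := (volume : Measure (ℝ × ℝ)))
    (s := ball (0 : ℝ) 1) (x₀ := (0 : ℝ)) (ball_mem_nhds (0 : ℝ) one_pos)
    (F := fun (t : ℝ) (z : ℝ × ℝ) => κ (z + t • u') * G z)
    (F' := fun (t : ℝ) (z : ℝ × ℝ) => fderiv ℝ κ (z + t • u') u' * G z)
    (bound := fun z => (closedBall (0 : ℝ × ℝ) (R + ‖u'‖)).indicator (fun _ => Cκ * ‖u'‖ * CF) z)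
    ?_ ?_ ?_ ?_ ?_ ?_
  · -- conclude by uniqueness of the derivative
    have hB' : HasDerivAt (fun t : ℝ => Φ (y + t • u))
        (∫ z : ℝ × ℝ, fderiv ℝ κ (z + (0 : ℝ) • u') u' * G z) 0 := by
      rw [hrew]; exact hB.2
    have := hA.unique hB'
    rw [this]
    simp [hG]
  · exact Eventually.of_forall fun t =>
      ((hκc.comp (continuous_id.add continuous_const)).mul hGc).aestronglyMeasurable
  · simp only [zero_smul, add_zero]
    exact (hκc.mul hGc).integrable_of_hasCompactSupport hκs.mul_right
  · exact (((hκc'.comp (continuous_id.add continuous_const)).clm_apply continuous_const).mul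
      hGc).aestronglyMeasurable
  · refine Eventually.of_forall fun z t ht => ?_
    by_cases hz : z ∈ closedBall (0 : ℝ × ℝ) (R + ‖u'‖)
    · rw [indicator_of_mem hz, norm_mul, Real.norm_eq_abs]
      have h1 : ‖fderiv ℝ κ (z + t • u') u'‖ ≤ Cκ * ‖u'‖ :=
        le_trans (ContinuousLinearMap.le_opNorm _ _) (mul_le_mul_of_nonneg_right (hCκ _) (norm_nonneg _))
      rw [Real.norm_eq_abs] at h1
      have h2 : |G z| ≤ CF := by have := hCF (fun j => y j - (![z.1, z.2, 0] : Fin 3 → ℝ) j); rwa [Real.norm_eq_abs] at this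
      exact mul_le_mul h1 h2 (abs_nonneg _) (by positivity)
    · rw [indicator_of_notMem hz, hvan z hz t ht]
      simp
  · exact (integrable_indicator_iff isClosed_closedBall.measurableSet).2
      ((integrableOn_const_iff).2 (Or.inr measure_closedBall_lt_top))
  · refine Eventually.of_forall fun z t _ => ?_
    have hl : HasDerivAt (fun t : ℝ => z + t • u') u' t := by
      have := ((hasDerivAt_id t).smul_const u').const_add z
      simpa using this
    have h := ((hκd (z + t • u')).hasFDerivAt.comp_hasDerivAt t hl).mul_const (G z)
    exact h

end Summit.Ventures.Crystal3D.Theorems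

end
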